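import Mathlib
import Summits.Ventures.HodgeRepro2.T5CyclotomicSubfieldHeckeInfinitude
import Summits.Ventures.HodgeRepro2.T5CyclotomicSubfieldCM
import Summits.Ventures.HodgeRepro2.T5CyclotomicSubfieldSexticCensus

/-!
# THE RECORD'S HECKE ALGEBRA ON A CM SUBFIELD OF `ℚ(ζₘ)`, IN ONE STATEMENT — AND THE SEXTIC CASE

Tier-5 support N3 / §G-N4.2 (seat p3, gen 82). The consumer statement of files 304 and 306 for a CM field GIVEN as
a subfield `F ⊆ ℚ(ζₘ)` with `−1 ∉ H_F` (file 297: that is exactly the CM subfields), everything read off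
`(ℤ/mℤ)ˣ / H_F`:

* **`cyclotomic_subfield_hecke_summary`**: (i) at every place `v` of `F⁺` above a prime `p ∤ m`, for every hermitian
  `H` with unit determinant good above `v`, every generator family `l` and every field `k`, the record's spherical
  Hecke algebra `H(U(1 ⊗ H), K_v)` is commutative, and it is `k[X]` when `(−1) · H_F ∈ ⟨p · H_F⟩`; (ii) the intrinsic
  form: commutative at every `v` with `m ∉ v`; (iii) for every `H` and `k`, `k[X]` at infinitely many places and
  commutative at infinitely many split places;
* **`sextic_cyclotomic_subfield_hecke`**: the brief's sextic Galois CM case on a cyclotomic presentation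
  (`[F : ℚ] = 6`): the same, with the `k[X]` condition read as the parity of `ord(p · H_F)` (file 296's cyclic
  bridge on file 281's cyclicity).

§8(d): uses an L-value-free non-vanishing device: NO.
-/

open Matrix NumberField NumberField.IsCMField IsDedekindDomain IsDedekindDomain.HeightOneSpectrum Module Polynomial
  Ideal
open scoped TensorProduct Pointwise
open Summit.Ventures.HodgeRepro2.T5UnitaryGroupForm Summit.Ventures.HodgeRepro2.T5UnitaryHeckeAdjoint
  Summit.Ventures.HodgeRepro2.T5HeckePermutationModule Summit.Ventures.HodgeRepro2.T5HeckeDoubleCoset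
  Summit.Ventures.HodgeRepro2.T5RecordHyperspecial Summit.Ventures.HodgeRepro2.T5GlobalLatticeAlmostAll
  Summit.Ventures.HodgeRepro2.T5FinitePlaceSplitClassification Summit.Ventures.HodgeRepro2.T5RecordSatakeIntrinsic
  Summit.Ventures.HodgeRepro2.T5SplitPlaceUnitaryGroup Summit.Ventures.HodgeRepro2.T5NonSplitPlaceUnitaryGroup
  Summit.Ventures.HodgeRepro2.T5FinitePlaceCM Summit.Ventures.HodgeRepro2.T5StarOfInvolution
  Summit.Ventures.HodgeRepro2.T5CyclotomicSubfieldHeckeCommutative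
  Summit.Ventures.HodgeRepro2.T5CyclotomicSubfieldHeckeInfinitude
  Summit.Ventures.HodgeRepro2.T5CyclotomicSubfieldInertiaDeg
  Summit.Ventures.HodgeRepro2.T5CyclotomicSubfieldInfinitude
  Summit.Ventures.HodgeRepro2.T5CyclotomicSubfieldCM

namespace Summit.Ventures.HodgeRepro2.T5CyclotomicSubfieldHeckeSummary

variable (m : ℕ) [NeZero m] (L : Type*) [Field L] [NumberField L] [IsCyclotomicExtension {m} ℚ L] [IsCMField L]
  (F : IntermediateField ℚ L) (hF : (-1 : (ZMod m)ˣ) ∉ zmodSubgroup m L F)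

include hF in
/-- **THE RECORD'S HECKE ALGEBRA ON A CM SUBFIELD `F ⊆ ℚ(ζₘ)`, IN ONE STATEMENT** (files 304 and 306): (i) commutative
at every place of `F⁺` above `p ∤ m` (good for `H`), `k[X]` there when `(−1) · H_F ∈ ⟨p · H_F⟩`; (ii) commutative at
every `v` with `m ∉ v`; (iii) `k[X]` at infinitely many places and commutative at infinitely many split places, for
every hermitian `H` with unit determinant and every field `k`. -/
theorem cyclotomic_subfield_hecke_summary :
    haveI := isCMField_of_neg_one_notMem m L F hF
    (∀ (p : ℕ) [Fact p.Prime] (hpm : p.Coprime m) (𝔭 : Ideal (𝓞 F)) [𝔭.IsPrime] [𝔭.LiesOver (span {(p : ℤ)})]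
      (v : HeightOneSpectrum (𝓞 (maximalRealSubfield F))) [𝔭.LiesOver v.asIdeal]
      {r : ℕ} (l : Fin r → 𝓞 F) (k : Type*) [Field k],
      Submodule.span (𝓞 (maximalRealSubfield F)) (Set.range l) = ⊤ →
      ∀ {H : Matrix (Fin 3) (Fin 3) F}, H.IsHermitian → IsUnit H.det →
      (∀ w : HeightOneSpectrum (𝓞 F), w.asIdeal.LiesOver v.asIdeal → w ∉ badSet H) →
      RecordCommutative F v l k H ∧
        ((QuotientGroup.mk (-1) : (ZMod m)ˣ ⧸ zmodSubgroup m L F) ∈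
            Subgroup.zpowers (QuotientGroup.mk (ZMod.unitOfCoprime p hpm)) →
          RecordPolynomial F v l k H)) ∧
    (∀ (v : HeightOneSpectrum (𝓞 (maximalRealSubfield F))),
      ((m : ℕ) : 𝓞 (maximalRealSubfield F)) ∉ v.asIdeal →
      ∀ {r : ℕ} (l : Fin r → 𝓞 F) (k : Type*) [Field k],
      Submodule.span (𝓞 (maximalRealSubfield F)) (Set.range l) = ⊤ →
      ∀ {H : Matrix (Fin 3) (Fin 3) F}, H.IsHermitian → IsUnit H.det →
      (∀ w : HeightOneSpectrum (𝓞 F), w.asIdeal.LiesOver v.asIdeal → w ∉ badSet H) →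
      RecordCommutative F v l k H) ∧
    (∀ (k : Type*) [Field k] {H : Matrix (Fin 3) (Fin 3) F}, H.IsHermitian → IsUnit H.det →
      {v : HeightOneSpectrum (𝓞 (maximalRealSubfield F)) | ∀ {r : ℕ} (l : Fin r → 𝓞 F),
        Submodule.span (𝓞 (maximalRealSubfield F)) (Set.range l) = ⊤ → RecordPolynomial F v l k H}.Infinite ∧
      {v : HeightOneSpectrum (𝓞 (maximalRealSubfield F)) | (v.asIdeal.primesOver (𝓞 F)).ncard = 2 ∧
        ∀ {r : ℕ} (l : Fin r → 𝓞 F), Submodule.span (𝓞 (maximalRealSubfield F)) (Set.range l) = ⊤ →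
          RecordCommutative F v l k H}.Infinite) := by
  haveI := isCMField_of_neg_one_notMem m L F hF
  refine ⟨fun p _ hpm 𝔭 _ _ v _ r l k _ hl H hH hdet hbad => ?_, fun v hmv r l k _ hl H hH hdet hbad => ?_,
    fun k _ H hH hdet => ?_⟩
  · exact ⟨recordCommutative_cyclotomic_subfield m L F p hpm 𝔭 v l k hl hH hdet hbad,
      fun hmem => recordPolynomial_cyclotomic_subfield_of_mem m L F p hpm 𝔭 v l k hmem hl hH hdet hbad⟩
  · exact recordCommutative_cyclotomic_subfield_of_notMem m L F v hmv l k hl hH hdet hbad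
  · exact ⟨infinite_setOf_recordPolynomial m L F k hH hdet,
      infinite_setOf_ncard_primesOver_eq_two_and_recordCommutative m L F k hH hdet⟩

include hF in
/-- **THE SEXTIC GALOIS CM CASE ON A CYCLOTOMIC PRESENTATION** (`[F : ℚ] = 6`, `−1 ∉ H_F`): at every place `v` of
`F⁺` above `p ∤ m` the record's spherical Hecke algebra is commutative, and it is `k[X]` exactly when `ord(p · H_F)`
is even (file 296's cyclic bridge on file 281's cyclicity of `Gal(F/ℚ)`); `k[X]` at infinitely many places. -/
theorem sextic_cyclotomic_subfield_hecke (h6 : Module.finrank ℚ F = 6) :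
    haveI := isCMField_of_neg_one_notMem m L F hF
    (∀ (p : ℕ) [Fact p.Prime] (hpm : p.Coprime m) (𝔭 : Ideal (𝓞 F)) [𝔭.IsPrime] [𝔭.LiesOver (span {(p : ℤ)})]
      (v : HeightOneSpectrum (𝓞 (maximalRealSubfield F))) [𝔭.LiesOver v.asIdeal]
      {r : ℕ} (l : Fin r → 𝓞 F) (k : Type*) [Field k],
      Submodule.span (𝓞 (maximalRealSubfield F)) (Set.range l) = ⊤ →
      ∀ {H : Matrix (Fin 3) (Fin 3) F}, H.IsHermitian → IsUnit H.det →
      (∀ w : HeightOneSpectrum (𝓞 F), w.asIdeal.LiesOver v.asIdeal → w ∉ badSet H) →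
      RecordCommutative F v l k H ∧
        (Even (orderOf (QuotientGroup.mk (ZMod.unitOfCoprime p hpm) : (ZMod m)ˣ ⧸ zmodSubgroup m L F)) →
          RecordPolynomial F v l k H)) ∧
    (∀ (k : Type*) [Field k] {H : Matrix (Fin 3) (Fin 3) F}, H.IsHermitian → IsUnit H.det →
      {v : HeightOneSpectrum (𝓞 (maximalRealSubfield F)) | ∀ {r : ℕ} (l : Fin r → 𝓞 F),
        Submodule.span (𝓞 (maximalRealSubfield F)) (Set.range l) = ⊤ → RecordPolynomial F v l k H}.Infinite) := by
  haveI := isCMField_of_neg_one_notMem m L F hF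
  haveI : IsGalois ℚ F := T5CyclotomicUnramified.isGalois_intermediateField L m F
  haveI : IsCyclic (F ≃ₐ[ℚ] F) := T5CMFieldCyclicGaloisCriterion.isCyclic_gal F h6
  refine ⟨fun p _ hpm 𝔭 _ _ v _ r l k _ hl H hH hdet hbad => ?_, fun k _ H hH hdet => ?_⟩
  · refine ⟨recordCommutative_cyclotomic_subfield m L F p hpm 𝔭 v l k hl hH hdet hbad, fun heven => ?_⟩
    exact recordPolynomial_cyclotomic_subfield_of_mem m L F p hpm 𝔭 v l k
      ((mem_zpowers_iff_even_orderOf_of_isCyclic m L F p hpm 𝔭 v).mpr heven) hl hH hdet hbad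
  · exact infinite_setOf_recordPolynomial m L F k hH hdet

end Summit.Ventures.HodgeRepro2.T5CyclotomicSubfieldHeckeSummary
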